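import Mathlib
import HarnessLib
import Summits.HubbardSuperconductivity.HubbardSuperconductivity.Theorems.KLProgrammeKLRegimeEnginePairTransferPHSignedGeneric
import Summits.HubbardSuperconductivity.HubbardSuperconductivity.Theorems.KLProgrammeLatticeSoftBubbleModelSharpTC

/-!
# Route `KLProgramme` — ENGINE item stmt-HubbardSuperconductivity-20437 `KLRegimeEngineV17F2`, class-#5 STEP (X).3 rows form / pinned pair «88b» /
# located-risk #14 «(X).3-PINNED-NUMERIC»: THE SIGNED MEMBER PH ROW with the SHARP zero-sound term AND the PATH transfer constant AND the SPLIT Matsubara count — `klmsRowBoundTC` and `klms_pinned_bubble_norm_leTC`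
# (cell gate-hubbard-kl, seat hubbard-kl-k3c2-p2 g22, technique «thermal-bar induction n ≤ nScales β + 1 with EngineBoundsAtV4S sums»)

Text-faithful twins (suffix `S`) of `klmsRowBound`, `klms_pinned_bubble_norm_le`, `klms_memberPH_direct_signed_le` (…PairTransferMemberPHSignedRow) built on
`klfl_lattice_soft_bubble_norm_le_modelTC` (…LatticeSoftBubbleModelSharpTR).  Three changes w.r.t. `klmsRowBound` (sharp zero-sound piece; path transfer constant; transfer piece split `256/π ↦ 64/π + 48/π·((π/β)/Λₙ₊₁)`): the zero-sound piece of the row bound: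
`(524288/π)·((8/Λ·8/Λ_j² + (2B₂+8)/Λ³)·Λ² + 8·(8/Λ))·geo·Λ` (Lipschitz-keyed, `= (524288/π)(ℓ+8M_F)·L_W·Λ`) becomes `(64/π)·(8/Λ)·geo·Λ`
(sup-keyed, `= (64/π)·M_F·L_W·Λ`, `M_F = 8/Λₙ₊₁`) — smaller by `2^21.2` at `j = n+1`; the thermal, transfer and lattice pieces and every hypothesis are
byte-identical except the cut partner's transfer constant `65ℓ′ + 17408M_f′/3 ↦ 3ℓ′ + 512M_f′` (`ℓ′ = 8·16^{j−(n+1)}`, `M_f′ = 1`; …MatsubaraSlicePropagatorPath) in the transfer and lattice pieces.  Consumers keyed on `klmsRowBound` BY NAME (…PHSignedGeneric → … → …DLineEdgeSplit3Door, `pinned_row_le_slots`) twin mechanically on these names.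
Pure composition of landed rows; nothing about the model's effective action is asserted; nothing asserts (X).3, (c), K3 or superconductivity.
References: BGM 2006 §2.4–2.5 [cite: BenfattoGiulianiMastropietro2006]; FST 1998 App. B [cite: FeldmanSalmhoferTrubowitz1998].
-/

noncomputable section

namespace Summit.HubbardSuperconductivity.HubbardSuperconductivity.Theorems.KLRegimeSplit

set_option linter.dupNamespace false -- summit = problem name (single-conjunct summit), D-0017

open Real Set Finset Complex Literature.MathematicalPhysics.QuantumLattice
open Literature.Probability.LatticeModels hiding torusSupNorm
open Literature.MathematicalPhysics.QuantumLattice.BandSectorCounting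
open Summit.HubbardSuperconductivity.HubbardSuperconductivity.Theorems.KLProgrammeLegKernels
open Summit.HubbardSuperconductivity.HubbardSuperconductivity.Theorems.KLRegimeWick
open Summit.HubbardSuperconductivity.HubbardSuperconductivity.Theorems.TwoPointAssembly
open Summit.HubbardSuperconductivity.HubbardSuperconductivity.Theorems.DispersionFlow
open Summit.HubbardSuperconductivity.HubbardSuperconductivity.Theorems.PerturbedFermiCurve

/-! ## §1 The row bound (sharp zero-sound piece) as a closed expression -/

/-- **The signed member row's right side, SHARP zero-sound piece** at index `n+1` (the right side of `klfl_lattice_soft_bubble_norm_le_modelTC` with the planar weight's data `(2A₀, 2L_A)`,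
the slice weight `klWdC Λ(t)` (`M_f = M_F = 8/Λₙ₊₁`, `ℓ_f = (2B₂+8)/Λₙ₊₁`), the partner `klPhiC Λ_j Λ(t)` (`M′ = 1`, `L_d = 8/Λ_j²`, `ℓ′ = 8·16^{j−(n+1)}`),
`q₀ = 0` and band shift `δ`); `d = Dt_min`, `A` = the frame's `C²` size, `G` = the band's Lipschitz constant. -/
def klmsRowBoundTC (d A G A₀ La β : ℝ) (n j : ℕ) (δ : ℝ) (L : ℕ) : ℝ :=
  ((2 * π) ^ 2)⁻¹ *
      (2 * Real.pi *
        (64 / Real.pi * (8 / klScale klE0 (n + 1)) *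
            (Real.pi * Real.sqrt 2 / (d - 4 * A) * (2 * La + 2 * A₀ * (2 / (1 / 10))) / (d - 4 * A) +
              2 * A₀ * (1 / (d - 4 * A) ^ 2 + Real.pi * Real.sqrt 2 * (2 + 4 * A) / (d - 4 * A) ^ 3)) * klScale klE0 (n + 1) +
          393216 / Real.pi *
              ((8 / klScale klE0 (n + 1) * (8 / klScale klE0 j ^ 2) +
                    1 * ((2 * (448 / 3 * Real.exp 2) + 8) / klScale klE0 (n + 1) / klScale klE0 (n + 1) ^ 2)) *
                  klScale klE0 (n + 1) ^ 2 +
                8 * (8 / klScale klE0 (n + 1))) *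
            (2 * A₀ * (Real.pi * Real.sqrt 2 / (d - 4 * A))) * ((Real.pi / β) / klScale klE0 (n + 1)) +
          (64 / Real.pi * (8 / klScale klE0 (n + 1)) * (2 * A₀ * (Real.pi * Real.sqrt 2 / (d - 4 * A))) *
            ((3 * (8 * (16 : ℝ) ^ (j - (n + 1))) + 512 * 1) / klScale klE0 (n + 1) ^ 2 * klScale klE0 (n + 1)) * (|(0 : ℝ)| + δ) +
            48 / Real.pi * (8 / klScale klE0 (n + 1)) * (2 * A₀ * (Real.pi * Real.sqrt 2 / (d - 4 * A))) *
            ((3 * (8 * (16 : ℝ) ^ (j - (n + 1))) + 512 * 1) / klScale klE0 (n + 1) ^ 2 * klScale klE0 (n + 1)) * (|(0 : ℝ)| + δ) * ((Real.pi / β) / klScale klE0 (n + 1))))) +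
    32 * klScale klE0 (n + 1) *
        (2 * La * (2 * (8 / klScale klE0 (n + 1)) / klScale klE0 (n + 1)) * (16 * 1 / klScale klE0 (n + 1)) +
          2 * A₀ * ((9 * ((2 * (448 / 3 * Real.exp 2) + 8) / klScale klE0 (n + 1)) + 4 * (8 / klScale klE0 (n + 1))) / klScale klE0 (n + 1) ^ 2 * G) *
            (16 * 1 / klScale klE0 (n + 1)) +
          2 * A₀ * (2 * (8 / klScale klE0 (n + 1)) / klScale klE0 (n + 1)) *
            ((3 * (8 * (16 : ℝ) ^ (j - (n + 1))) + 512 * 1) / klScale klE0 (n + 1) ^ 2 * G)) / L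


/-! ## §2 The signed member PH row, assembled (sharp zero-sound piece) -/

section Model

variable {L M : ℕ} [NeZero L] {a' b' : ℝ} (B : BandBounds a' b') {R : RenConsts} {U μ : ℝ} {N : ℕ} {K : TrigPolyC4v} {A : ℝ}

/-- One pinned bubble: the momentum-only weight `Y` (sup `A₀`, torus-Lipschitz `L_A`) against the slice line and the partner `Φ_j(t)` at transfer `q̃`,
`G·|p_q̃|_𝕋 ≤ Λₙ₊₁/8`: `‖Σ_p Y(k̃)·Φ_Ẇ(ω_p, e_K k̃)·Φ_{Φ_j}(ω_p, e_K(k̃ + q̃))‖ ≤ βL²·klmsRowBound … (G·|p_q̃|_𝕋) L`. -/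
theorem klms_pinned_bubble_norm_leTC (hR : ∀ j, 0 ≤ R.Gfr j) (hK : FrameOK R U N μ K)
    (hAb : ∀ p : Momentum, ∀ j ≤ 2, ‖iteratedFDeriv ℝ j (frameShift K) p‖ ≤ A) (hA : 4 * A < B.Dtmin) (hA20 : 4 * A ≤ 1 / 20) (hμ : μ ≤ -0.15)
    (n : ℕ) {t : ℝ} (ht : t ∈ Icc (0 : ℝ) 1) {j : ℕ} (hj : n + 1 ≤ j)
    (hlo : a' < μ - 4 * klScale klE0 (n + 1) - 4 * A) (hhi : μ + 4 * klScale klE0 (n + 1) + 4 * A < b')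
    {β : ℝ} (hβ : klBetaMin ≤ β) (hn : n + 1 ≤ nScales β + 1) (hM : β * (4 * klScale klE0 (n + 1)) / (2 * Real.pi) + 1 ≤ M)
    (q : TorusSite 2 L) (hq : (4 + 8 / 3 * R.Gfr 1 * U ^ 2) * klTorusNorm L q ≤ klScale klE0 (n + 1) / 8)
    {Y : TorusSite 2 L → ℂ} {A₀ LA : ℝ} (hA0 : 0 ≤ A₀) (hLA : 0 ≤ LA) (hY0 : ∀ k, ‖Y k‖ ≤ A₀)
    (hY1 : ∀ k k', ‖Y k - Y k'‖ ≤ LA * klTorusNorm L (k - k')) :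
    ‖∑ p : FreqMomentum L M, Y p.2 *
        (klfb_prop (klWdC (klScale klE0 n + t * (klScale klE0 (n + 1) - klScale klE0 n))) (matsubaraFreq β M p.1) (nambuXiCT L μ K p.2) *
          klfb_prop (klPhiC (klScale klE0 j) (klScale klE0 n + t * (klScale klE0 (n + 1) - klScale klE0 n))) (matsubaraFreq β M p.1)
            (nambuXiCT L μ K (p.2 + q)))‖ ≤
      β * (L : ℝ) ^ 2 * klmsRowBoundTC B.Dtmin A (4 + 8 / 3 * R.Gfr 1 * U ^ 2) A₀ LA β n j ((4 + 8 / 3 * R.Gfr 1 * U ^ 2) * klTorusNorm L q) L := by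
  set Λt : ℝ := klScale klE0 n + t * (klScale klE0 (n + 1) - klScale klE0 n) with hΛt
  obtain ⟨hlo', hhi'⟩ := scaleAt_mem n ht
  have hΛ1 := klth_klScale_pos (n + 1)
  have hβ0 : 0 < β := lt_of_lt_of_le (by norm_num [klBetaMin]) hβ
  -- the planar weight
  set a : ℝ × ℝ → ℂ := klpeExt Y A₀ LA with ha
  -- the weights' hypotheses at index `n+1`
  obtain ⟨hbd, hlip, hin, hout⟩ := klfw_sliceWeight_hypotheses hlo' hhi'
  obtain ⟨hdbd, hdlip, -, -⟩ := klfw_partner_hypotheses hlo' hhi' hj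
  obtain ⟨hFbd, hFlip⟩ := klfw_product_hypotheses hlo' hhi' hj
  have hLf' : 8 / klScale klE0 j ^ 2 ≤ 8 * (16 : ℝ) ^ (j - (n + 1)) / klScale klE0 (n + 1) ^ 2 := (klfw_partner_lipschitz_scale hj).le
  have hLF : 8 / klScale klE0 (n + 1) * (8 / klScale klE0 j ^ 2) + 1 * ((2 * (448 / 3 * Real.exp 2) + 8) / klScale klE0 (n + 1) / klScale klE0 (n + 1) ^ 2) ≤
      (8 / klScale klE0 (n + 1) * (8 / klScale klE0 j ^ 2) + 1 * ((2 * (448 / 3 * Real.exp 2) + 8) / klScale klE0 (n + 1) / klScale klE0 (n + 1) ^ 2)) *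
          klScale klE0 (n + 1) ^ 2 / klScale klE0 (n + 1) ^ 2 :=
    le_of_eq (by rw [mul_div_cancel_right₀ _ (pow_ne_zero 2 hΛ1.ne')])
  have hq₀ : |(0 : ℝ)| ≤ klScale klE0 (n + 1) / 8 := by rw [abs_zero]; positivity
  have h := klfl_lattice_soft_bubble_norm_le_modelTC B hR hK hAb hA hA20 hμ (klpe_continuous_ext Y A₀ hLA) (klpe_ext_periodic₁ Y A₀ LA)
    (klpe_ext_periodic₂ Y A₀ LA) (klpe_norm_ext_le Y hA0 LA) (klpe_ext_lipschitz Y A₀ hLA) (n := n + 1) (Nat.le_add_left 1 n) q hq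
    hlip hbd le_rfl hin hout hdlip hdbd hLf' (by positivity) hFlip hFbd hLF hlo hhi hq₀ hβ hn hM
  -- the normalisation and the lattice values of the planar weight
  have hsum : (∑ p : FreqMomentum L M, Y p.2 *
        (klfb_prop (klWdC Λt) (matsubaraFreq β M p.1) (nambuXiCT L μ K p.2) * klfb_prop (klPhiC (klScale klE0 j) Λt) (matsubaraFreq β M p.1) (nambuXiCT L μ K (p.2 + q)))) =
      (((β * (L : ℝ) ^ 2 : ℝ)) : ℂ) * (β⁻¹ • ∑ i : MatsubaraIdx M, ((L ^ 2 : ℕ) : ℝ)⁻¹ • ∑ k : TorusSite 2 L,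
        a (latticeMomentum L k 0, latticeMomentum L k 1) * klfb_prop (klWdC Λt) (matsubaraFreq β M i) (nambuXiCT L μ K k) *
          klfb_prop (klPhiC (klScale klE0 j) Λt) (matsubaraFreq β M i + 0) (nambuXiCT L μ K (k + q))) := by
    rw [← klrf_sum_freqMomentum_eq_smul hβ0.ne']
    refine Finset.sum_congr rfl fun p _ => ?_
    rw [ha, klpe_ext_apply_latticeMomentum hY0 hY1, add_zero, mul_assoc]
  rw [hsum, norm_mul, Complex.norm_real, Real.norm_of_nonneg (by positivity)]
  refine mul_le_mul_of_nonneg_left ?_ (by positivity)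
  unfold klmsRowBoundTC
  exact h

/-- **THE SIGNED MEMBER PH ROW, ASSEMBLED** (see the module docstring). -/
theorem klms_memberPH_direct_signed_leTC [NeZero M] (hR : ∀ j, 0 ≤ R.Gfr j) (hK : FrameOK R U N μ K)
    (hAb : ∀ p : Momentum, ∀ j ≤ 2, ‖iteratedFDeriv ℝ j (frameShift K) p‖ ≤ A) (hA : 4 * A < B.Dtmin) (hA20 : 4 * A ≤ 1 / 20) (hμ : μ ≤ -0.15)
    (n : ℕ) {t : ℝ} (ht : t ∈ Icc (0 : ℝ) 1) {β : ℝ} (hβ : klBetaMin ≤ β) (hn : n + 1 ≤ nScales β + 1)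
    (hM : β * (4 * klScale klE0 (n + 1)) / (2 * Real.pi) + 1 ≤ M)
    (Φ : ℕ → ℝ → FreqMomentum L M → ℝ) (hΦ : Φ = fun j t k => (softSymbolCompl L M β μ K (n + 1) j) k + (hubbardCutoffWeightCT L M β μ K (klScale klE0 (n + 1)) k -
            hubbardCutoffWeightCT L M β μ K (klScale klE0 n + t * (klScale klE0 (n + 1) - klScale klE0 n)) k))
    (Wd : ℝ → FreqMomentum L M → ℝ) (hWd : Wd = fun t k => deriv (fun Λ' : ℝ => hubbardCutoffWeightCT L M β μ K Λ' k) (klScale klE0 n + t * (klScale klE0 (n + 1) - klScale klE0 n)))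
    (V : ℕ → ℝ → (Fin 4 → HubbardFieldIdx L M) → ℂ) {j : ℕ} (hj : n + 1 ≤ j) (Qm x y : TorusSite 2 L)
    (hlo : a' < μ - 4 * klScale klE0 (n + 1) - 4 * A) (hhi : μ + 4 * klScale klE0 (n + 1) + 4 * A < b')
    (hq : (4 + 8 / 3 * R.Gfr 1 * U ^ 2) * klTorusNorm L (x - y) ≤ klScale klE0 (n + 1) / 8)
    {A₀ LA ε : ℝ} (hA0 : 0 ≤ A₀) (hLA : 0 ≤ LA) (hε : 0 ≤ ε)
    (hY0p : ∀ k : TorusSite 2 L, ‖∑ σ : Fin 2, V j t ![(((omega0 M, k), σ), 1), (((omega0 M, k + (x - y)), σ), 0), (((omega0 M, y), 0), 0), (((omega0 M, x), 0), 1)] *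
        V j t ![(((omega0 M, k), σ), 0), (((omega0 M, k + (x - y)), σ), 1), ((((omega0 M).rev, Qm - y), 1), 0), ((((omega0 M).rev, Qm - x), 1), 1)]‖ ≤ A₀)
    (hY1p : ∀ k k' : TorusSite 2 L, ‖(∑ σ : Fin 2, V j t ![(((omega0 M, k), σ), 1), (((omega0 M, k + (x - y)), σ), 0), (((omega0 M, y), 0), 0), (((omega0 M, x), 0), 1)] *
          V j t ![(((omega0 M, k), σ), 0), (((omega0 M, k + (x - y)), σ), 1), ((((omega0 M).rev, Qm - y), 1), 0), ((((omega0 M).rev, Qm - x), 1), 1)]) -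
        ∑ σ : Fin 2, V j t ![(((omega0 M, k'), σ), 1), (((omega0 M, k' + (x - y)), σ), 0), (((omega0 M, y), 0), 0), (((omega0 M, x), 0), 1)] *
          V j t ![(((omega0 M, k'), σ), 0), (((omega0 M, k' + (x - y)), σ), 1), ((((omega0 M).rev, Qm - y), 1), 0), ((((omega0 M).rev, Qm - x), 1), 1)]‖ ≤
        LA * klTorusNorm L (k - k'))
    (hY0m : ∀ k : TorusSite 2 L, ‖∑ σ : Fin 2, V j t ![(((omega0 M, k + -(x - y)), σ), 1), (((omega0 M, k), σ), 0), (((omega0 M, y), 0), 0), (((omega0 M, x), 0), 1)] *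
        V j t ![(((omega0 M, k + -(x - y)), σ), 0), (((omega0 M, k), σ), 1), ((((omega0 M).rev, Qm - y), 1), 0), ((((omega0 M).rev, Qm - x), 1), 1)]‖ ≤ A₀)
    (hY1m : ∀ k k' : TorusSite 2 L, ‖(∑ σ : Fin 2, V j t ![(((omega0 M, k + -(x - y)), σ), 1), (((omega0 M, k), σ), 0), (((omega0 M, y), 0), 0), (((omega0 M, x), 0), 1)] *
          V j t ![(((omega0 M, k + -(x - y)), σ), 0), (((omega0 M, k), σ), 1), ((((omega0 M).rev, Qm - y), 1), 0), ((((omega0 M).rev, Qm - x), 1), 1)]) -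
        ∑ σ : Fin 2, V j t ![(((omega0 M, k' + -(x - y)), σ), 1), (((omega0 M, k'), σ), 0), (((omega0 M, y), 0), 0), (((omega0 M, x), 0), 1)] *
          V j t ![(((omega0 M, k' + -(x - y)), σ), 0), (((omega0 M, k'), σ), 1), ((((omega0 M).rev, Qm - y), 1), 0), ((((omega0 M).rev, Qm - x), 1), 1)]‖ ≤
        LA * klTorusNorm L (k - k'))
    (hflat : ∀ (i : MatsubaraIdx M) (σ : Fin 2) (k k' : TorusSite 2 L), matsubaraFreq β M i ^ 2 ≤ (4 * klScale klE0 (n + 1)) ^ 2 →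
      ‖V j t ![(((i, k), σ), 1), (((i, k'), σ), 0), (((omega0 M, y), 0), 0), (((omega0 M, x), 0), 1)] *
            V j t ![(((i, k), σ), 0), (((i, k'), σ), 1), ((((omega0 M).rev, Qm - y), 1), 0), ((((omega0 M).rev, Qm - x), 1), 1)] -
          V j t ![(((omega0 M, k), σ), 1), (((omega0 M, k'), σ), 0), (((omega0 M, y), 0), 0), (((omega0 M, x), 0), 1)] *
            V j t ![(((omega0 M, k), σ), 0), (((omega0 M, k'), σ), 1), ((((omega0 M).rev, Qm - y), 1), 0), ((((omega0 M).rev, Qm - x), 1), 1)]‖ ≤ ε) :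
    ‖∑ p : FreqMomentum L M, ∑ σ : Fin 2, ∑ p' : FreqMomentum L M,
        if matsubaraInt M p'.1 + matsubaraInt M (omega0 M) = matsubaraInt M p.1 + matsubaraInt M (omega0 M) ∧ p'.2 = p.2 + x - y then
          ((((((Φ j t p) : ℝ) : ℂ) * (((β * (L : ℝ) ^ 2 : ℝ) : ℂ) * propCT L M β μ K p)) * ((((Wd t p') : ℝ) : ℂ) * (((β * (L : ℝ) ^ 2 : ℝ) : ℂ) * propCT L M β μ K p'))) +
              (((((Wd t p) : ℝ) : ℂ) * (((β * (L : ℝ) ^ 2 : ℝ) : ℂ) * propCT L M β μ K p)) * ((((Φ j t p') : ℝ) : ℂ) * (((β * (L : ℝ) ^ 2 : ℝ) : ℂ) * propCT L M β μ K p')))) *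
            (V j t ![((p, σ), 1), ((p', σ), 0), (((omega0 M, y), 0), 0), (((omega0 M, x), 0), 1)] *
              V j t ![((p, σ), 0), ((p', σ), 1), ((((omega0 M).rev, Qm - y), 1), 0), ((((omega0 M).rev, Qm - x), 1), 1)])
        else 0‖ ≤
      (β * (L : ℝ) ^ 2) ^ 2 *
          (β * (L : ℝ) ^ 2 * klmsRowBoundTC B.Dtmin A (4 + 8 / 3 * R.Gfr 1 * U ^ 2) A₀ LA β n j ((4 + 8 / 3 * R.Gfr 1 * U ^ 2) * klTorusNorm L (x - y)) L +
            β * (L : ℝ) ^ 2 * klmsRowBoundTC B.Dtmin A (4 + 8 / 3 * R.Gfr 1 * U ^ 2) A₀ LA β n j ((4 + 8 / 3 * R.Gfr 1 * U ^ 2) * klTorusNorm L (x - y)) L) +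
        ε * (512 / 3 * (β * (L : ℝ) ^ 2) ^ 2 / (klScale klE0 n + t * (klScale klE0 (n + 1) - klScale klE0 n)) ^ 2 *
          ∑ p : FreqMomentum L M, |Φ j t p| * ‖propCT L M β μ K p‖) := by
  have hβ0 : 0 < β := lt_of_lt_of_le (by norm_num [klBetaMin]) hβ
  have h0 := klms_memberPH_direct_norm_le β μ K hβ0 n ht Φ hΦ Wd hWd V j Qm x y hε hflat
  refine h0.trans (add_le_add (mul_le_mul_of_nonneg_left (add_le_add ?_ ?_) (by positivity)) le_rfl)
  · exact klms_pinned_bubble_norm_leTC B hR hK hAb hA hA20 hμ n ht hj hlo hhi hβ hn hM (x - y) hq hA0 hLA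
      (Y := fun k : TorusSite 2 L => ∑ σ : Fin 2, V j t ![(((omega0 M, k), σ), 1), (((omega0 M, k + (x - y)), σ), 0), (((omega0 M, y), 0), 0), (((omega0 M, x), 0), 1)] *
        V j t ![(((omega0 M, k), σ), 0), (((omega0 M, k + (x - y)), σ), 1), ((((omega0 M).rev, Qm - y), 1), 0), ((((omega0 M).rev, Qm - x), 1), 1)])
      hY0p hY1p
  · have hq' : (4 + 8 / 3 * R.Gfr 1 * U ^ 2) * klTorusNorm L (-(x - y)) ≤ klScale klE0 (n + 1) / 8 := by rwa [klTorusNorm_neg]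
    have h := klms_pinned_bubble_norm_leTC B hR hK hAb hA hA20 hμ n ht hj hlo hhi hβ hn hM (-(x - y)) hq' hA0 hLA
      (Y := fun k : TorusSite 2 L => ∑ σ : Fin 2, V j t ![(((omega0 M, k + -(x - y)), σ), 1), (((omega0 M, k), σ), 0), (((omega0 M, y), 0), 0), (((omega0 M, x), 0), 1)] *
        V j t ![(((omega0 M, k + -(x - y)), σ), 0), (((omega0 M, k), σ), 1), ((((omega0 M).rev, Qm - y), 1), 0), ((((omega0 M).rev, Qm - x), 1), 1)])
      hY0m hY1m
    rw [klTorusNorm_neg] at h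
    exact h

end Model

/-! ## §3 The pinned bubble with partner `klPhiC Λ_m Λ′`, `Λ′ ∈ [Λₙ₊₁, Λₙ]`, and a frequency shift (twin of …PHSignedGeneric §2) -/

section Generic

variable {L M : ℕ} [NeZero L] [NeZero M] (β μ : ℝ) (K : TrigPolyC4v)
variable {a' b' : ℝ} (B : BandBounds a' b') {R : RenConsts} {U : ℝ} {N : ℕ} {A : ℝ}

omit [NeZero M] in
/-- **PINNED BUBBLE, general partner scale**: `d = klPhiC Λ_m Λ′` with `n+1 ≤ m`, `Λₙ₊₁ ≤ Λ′ ≤ Λₙ`, shift `|q₀| ≤ Λₙ₊₁/8`, momentum-only weight `Y` (`A₀`, `L_A`):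
`‖Σ_p Y(k̃)·Φ_Ẇ(ω_p, e_K k̃)·Φ_d(ω_p + q₀, e_K(k̃ + q̃))‖ ≤ βL²·klmsRowBoundTC d A G A₀ L_A β n m (|q₀| + G|p_q̃|_𝕋) L`. -/
theorem klms_pinned_bubble_norm_le_genTC (hR : ∀ j, 0 ≤ R.Gfr j) (hK : FrameOK R U N μ K)
    (hAb : ∀ p : Momentum, ∀ j ≤ 2, ‖iteratedFDeriv ℝ j (frameShift K) p‖ ≤ A) (hA : 4 * A < B.Dtmin) (hA20 : 4 * A ≤ 1 / 20) (hμ : μ ≤ -0.15)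
    (n : ℕ) {t : ℝ} (ht : t ∈ Icc (0 : ℝ) 1) {m : ℕ} (hm : n + 1 ≤ m) {Λ' : ℝ} (hlo'' : klScale klE0 (n + 1) ≤ Λ') (hhi'' : Λ' ≤ klScale klE0 n)
    (hlo : a' < μ - 4 * klScale klE0 (n + 1) - 4 * A) (hhi : μ + 4 * klScale klE0 (n + 1) + 4 * A < b')
    (hβ : klBetaMin ≤ β) (hn : n + 1 ≤ nScales β + 1) (hM : β * (4 * klScale klE0 (n + 1)) / (2 * Real.pi) + 1 ≤ M)
    (q : TorusSite 2 L) (hq : (4 + 8 / 3 * R.Gfr 1 * U ^ 2) * klTorusNorm L q ≤ klScale klE0 (n + 1) / 8) {q₀ : ℝ} (hq₀ : |q₀| ≤ klScale klE0 (n + 1) / 8)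
    {Y : TorusSite 2 L → ℂ} {A₀ LA : ℝ} (hA0 : 0 ≤ A₀) (hLA : 0 ≤ LA) (hY0 : ∀ k, ‖Y k‖ ≤ A₀)
    (hY1 : ∀ k k', ‖Y k - Y k'‖ ≤ LA * klTorusNorm L (k - k')) :
    ‖∑ p : FreqMomentum L M, Y p.2 *
        (klfb_prop (klWdC (klScale klE0 n + t * (klScale klE0 (n + 1) - klScale klE0 n))) (matsubaraFreq β M p.1) (nambuXiCT L μ K p.2) *
          klfb_prop (klPhiC (klScale klE0 m) Λ') (matsubaraFreq β M p.1 + q₀) (nambuXiCT L μ K (p.2 + q)))‖ ≤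
      β * (L : ℝ) ^ 2 * klmsRowBoundTC B.Dtmin A (4 + 8 / 3 * R.Gfr 1 * U ^ 2) A₀ LA β n m (|q₀| + (4 + 8 / 3 * R.Gfr 1 * U ^ 2) * klTorusNorm L q) L := by
  set Λt : ℝ := klScale klE0 n + t * (klScale klE0 (n + 1) - klScale klE0 n) with hΛt
  obtain ⟨hlo', hhi'⟩ := scaleAt_mem n ht
  have hΛ1 := klth_klScale_pos (n + 1)
  have hβ0 : 0 < β := lt_of_lt_of_le (by norm_num [klBetaMin]) hβ
  set a : ℝ × ℝ → ℂ := klpeExt Y A₀ LA with ha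
  obtain ⟨hbd, hlip, hin, hout⟩ := klfw_sliceWeight_hypotheses hlo' hhi'
  obtain ⟨hdbd, hdlip, -, -⟩ := klfw_partner_hypotheses hlo'' hhi'' hm
  have hFbd : ∀ s, ‖klWdC Λt s * klPhiC (klScale klE0 m) Λ' s‖ ≤ 8 / klScale klE0 (n + 1) := fun s =>
    (klwt_mul_norm_le hbd hdbd s).trans (by rw [mul_one])
  have hFlip := klwt_mul_lipschitz hbd hdbd hlip hdlip
  have hLf' : 8 / klScale klE0 m ^ 2 ≤ 8 * (16 : ℝ) ^ (m - (n + 1)) / klScale klE0 (n + 1) ^ 2 := (klfw_partner_lipschitz_scale hm).le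
  have hLF : 8 / klScale klE0 (n + 1) * (8 / klScale klE0 m ^ 2) + 1 * ((2 * (448 / 3 * Real.exp 2) + 8) / klScale klE0 (n + 1) / klScale klE0 (n + 1) ^ 2) ≤
      (8 / klScale klE0 (n + 1) * (8 / klScale klE0 m ^ 2) + 1 * ((2 * (448 / 3 * Real.exp 2) + 8) / klScale klE0 (n + 1) / klScale klE0 (n + 1) ^ 2)) *
          klScale klE0 (n + 1) ^ 2 / klScale klE0 (n + 1) ^ 2 :=
    le_of_eq (by rw [mul_div_cancel_right₀ _ (pow_ne_zero 2 hΛ1.ne')])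
  have h := klfl_lattice_soft_bubble_norm_le_modelTC B hR hK hAb hA hA20 hμ (klpe_continuous_ext Y A₀ hLA) (klpe_ext_periodic₁ Y A₀ LA)
    (klpe_ext_periodic₂ Y A₀ LA) (klpe_norm_ext_le Y hA0 LA) (klpe_ext_lipschitz Y A₀ hLA) (n := n + 1) (Nat.le_add_left 1 n) q hq
    hlip hbd le_rfl hin hout hdlip hdbd hLf' (by positivity) hFlip hFbd hLF hlo hhi hq₀ hβ hn hM
  have hsum : (∑ p : FreqMomentum L M, Y p.2 *
        (klfb_prop (klWdC Λt) (matsubaraFreq β M p.1) (nambuXiCT L μ K p.2) *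
          klfb_prop (klPhiC (klScale klE0 m) Λ') (matsubaraFreq β M p.1 + q₀) (nambuXiCT L μ K (p.2 + q)))) =
      (((β * (L : ℝ) ^ 2 : ℝ)) : ℂ) * (β⁻¹ • ∑ i : MatsubaraIdx M, ((L ^ 2 : ℕ) : ℝ)⁻¹ • ∑ k : TorusSite 2 L,
        a (latticeMomentum L k 0, latticeMomentum L k 1) * klfb_prop (klWdC Λt) (matsubaraFreq β M i) (nambuXiCT L μ K k) *
          klfb_prop (klPhiC (klScale klE0 m) Λ') (matsubaraFreq β M i + q₀) (nambuXiCT L μ K (k + q))) := by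
    rw [← klrf_sum_freqMomentum_eq_smul hβ0.ne']
    refine Finset.sum_congr rfl fun p _ => ?_
    rw [ha, klpe_ext_apply_latticeMomentum hY0 hY1, mul_assoc]
  rw [hsum, norm_mul, Complex.norm_real, Real.norm_of_nonneg (by positivity)]
  refine mul_le_mul_of_nonneg_left ?_ (by positivity)
  unfold klmsRowBoundTC
  rw [abs_zero, zero_add]
  exact h

end Generic

/-! ## §4 The exact reading of the sharp row in the STEP's normalisation (twin of …MemberPHSignedRoom `klmsRowBound_reading`) -/

/-- **EXACT READING of the signed member row in the STEP's normalisation** (`Λₙ − Λₙ₊₁ = 3Λₙ₊₁`):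
`(Λₙ − Λₙ₊₁)·klmsRowBoundTC = (3/(2π))·(ZS₀·Λₙ₊₁ + TH₀·((π/β)/Λₙ₊₁) + TR₀·((|0| + δ)/Λₙ₊₁)) + LAT₀/L`. -/
theorem klmsRowBoundTC_reading (d A G A₀ La β : ℝ) (n j : ℕ) (δ : ℝ) (L : ℕ) [NeZero L] :
    (klScale klE0 n - klScale klE0 (n + 1)) * klmsRowBoundTC d A G A₀ La β n j δ L =
      3 / (2 * π) *
          ((64 / Real.pi * 8 *
                (Real.pi * Real.sqrt 2 / (d - 4 * A) * (2 * La + 2 * A₀ * (2 / (1 / 10))) / (d - 4 * A) +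
                  2 * A₀ * (1 / (d - 4 * A) ^ 2 + Real.pi * Real.sqrt 2 * (2 + 4 * A) / (d - 4 * A) ^ 3))) *
              klScale klE0 (n + 1) +
            (393216 / Real.pi * (64 * (klScale klE0 (n + 1) / klScale klE0 j) ^ 2 + (2 * (448 / 3 * Real.exp 2) + 8) + 64) *
                (2 * A₀ * (Real.pi * Real.sqrt 2 / (d - 4 * A)))) *
              ((Real.pi / β) / klScale klE0 (n + 1)) +
            ((64 / Real.pi * 8 * (2 * A₀ * (Real.pi * Real.sqrt 2 / (d - 4 * A))) * (3 * (8 * (16 : ℝ) ^ (j - (n + 1))) + 512 * 1) +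
               48 / Real.pi * 8 * (2 * A₀ * (Real.pi * Real.sqrt 2 / (d - 4 * A))) * (3 * (8 * (16 : ℝ) ^ (j - (n + 1))) + 512 * 1) * ((Real.pi / β) / klScale klE0 (n + 1)))) *
              ((|(0 : ℝ)| + δ) / klScale klE0 (n + 1))) +
        96 * (512 * La / klScale klE0 (n + 1) +
            32 * A₀ * G * ((9 * (2 * (448 / 3 * Real.exp 2) + 8) + 4 * 8) + (3 * (8 * (16 : ℝ) ^ (j - (n + 1))) + 512 * 1)) /
              klScale klE0 (n + 1) ^ 2) / L := by
  have hΛ := (klth_klScale_pos (n + 1)).ne'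
  have hΛj := (klth_klScale_pos j).ne'
  have hL : ((L : ℝ)) ≠ 0 := by exact_mod_cast NeZero.ne L
  have hπ : Real.pi ≠ 0 := Real.pi_pos.ne'
  have h4 : klScale klE0 n = 4 * klScale klE0 (n + 1) := by rw [klth_klScale_succ]; ring
  unfold klmsRowBoundTC
  rw [h4]
  field_simp
  ring

end Summit.HubbardSuperconductivity.HubbardSuperconductivity.Theorems.KLRegimeSplit

end
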